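/-
Copyright: the b2b-balaban cell (near-miss cell 7), T⁴-continuum fan-out; row NE7b CRUX team (2), seat
t4-ne7b-formalise-leaf-03 (gen 22) (row S12 «ASSEMBLY» custodian; the OWNER's INTERFACE REQUEST NE7b IR-42-2 under
ruling R-OWNER-42-2 «M5's cost side is stated in TOTAL (lifeCost) form»).  Released under the licence of the
surrounding project.
-/
import Summits.QuantumFields.BalabanUV.T4Continuum.Support.HistoryAssemblyMult

/-!
# History assembly, multiplicity socket: the floor-level slack WITH THE COST READING IN TOTAL FORM (IR-42-2, T1′)

Summits-side support leaf of the T⁴-continuum cell (rung (B)+1 on a FINITE torus only; NOT infinite volume, NOT the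
mass gap, NOT the Clay statement; NOT a proof of the spine estimate NE7b, which is the cell's OWN estimate, NOT PRINTED
and NOT PROVED).  Row NE7b, route «COUNT», re-open object (α): the OWNER's ruling R-OWNER-42-2 reads the END's
realised-cost binder `hκ` in TOTAL form — `lifeCost (padW (dictWT sh R C.n₁) D) κ G ≤ lifeCost (padW …) (costT sh C K R) G`
over the padded life — instead of the STEPWISE form `∀ n ∈ life (padW …) G, κ G n ≤ costT sh C K R G n` (located
design observation O-M5-1).  On the FLOOR Mult road of the S12-W work list (W4b `HistoryAssemblyRealiseRunMultW` → W5 →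
W6 → W7 → E4 → E7) the stepwise binder is consumed ONLY by `HistoryAssemblyMult.card_mul_pshapeTH_le_priceT`, through
`HistoryConstantsTH`'s per-member step `pshapeTH_mul_exp_le_shapeTH_of_slack`, and there solely as
`lifeCostT_mono h = Finset.sum_le_sum h`.  This file states `card_mul_pshapeTH_le_priceT` with the binder in total form;
the per-member step is re-derived INSIDE the proof from `creditsT_slack` (no second declaration of `HistoryConstantsTH`'s
lemma: its total twin is leaf-04's IR-42-1 file `HistoryConstantsTHTotal`; this module does not depend on it).  A
kernel-checked `example` records that the landed stepwise lemma is the total one composed with `lifeCostT_mono`.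
[folklore] arithmetic over the lineage's OWN price letters (`pshapeTH`, `priceT`, `shapeTH`); nothing quoted from print,
nothing printed asserted, no `[cite:]` tag, no definition, no `Prop` fact, zero `sorry`.  Sibling of the PROFILE-road
file `HistoryAssemblyMultProfileTotal` (IR-42-2 T0).

WHAT.  **`card_mul_pshapeTH_le_priceT_total`** (binders of `HistoryAssemblyMult.card_mul_pshapeTH_le_priceT` VERBATIM
except `hκ : lifeCost (padW (dictWT sh (R K) C.n₁) 0) κ q.2 ≤ lifeCost (padW (dictWT sh (R K) C.n₁) 0) (costT sh C K (R K)) q.2`;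
conclusion identical); one round-trip `example`.

HONEST SCOPE.  Arithmetic only; a by-name WEAKENING of one displayed binder (class R of the END's H3 cost field
UNCHANGED until the owner's M5-1 discharges it); `hslack` stays a displayed hypothesis; nothing of H3 ∕ (B) ∕ BetaPertH
touched; NE7b NOT proved; spine 0∕9.  HONEST DEPENDENCY (cell): continuum YM on T⁴ ⇐ BetaPertH ∧ nine spine estimates
(0/9 proved); BetaPertH ⇐ (D1) ∧ (D4) ∧ CAP+tail; G-an2-4 gates asym, D1 and NE2/3/4.  This file changes none of it.
-/

open Finset
open Literature.MathematicalPhysics.QuantumFieldTheory.Balaban1983to89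
open T4PersistenceDictionary T4PersistentHistoryCount T4BankedInduction T4PrintedShapeBanking
open T4LiveClassFibration T4LiveStructureGas T4BranchingRecordsGas T4TaggedShapeBanking T4PartnerMultiplicity
open Summit.QuantumFields.BalabanUV.T4Continuum.LateMergers
open Summit.QuantumFields.BalabanUV.T4Continuum.HistorySocketTH
open Summit.QuantumFields.BalabanUV.T4Continuum.HistoryAssemblyTerms
open Summit.QuantumFields.BalabanUV.T4Continuum.HistoryAssemblyTermsLE
open Summit.QuantumFields.BalabanUV.T4Continuum.HistoryConstants
open Summit.QuantumFields.BalabanUV.T4Continuum.HistoryAssemblyPrice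
open Summit.QuantumFields.BalabanUV.T4Continuum.HistoryBankingLE
open Summit.QuantumFields.BalabanUV.T4Continuum.HistoryAssemblyMult

namespace Summit.QuantumFields.BalabanUV.T4Continuum.HistoryAssemblyMultTotal

noncomputable section

/-! ## The class-linear slack at the profile floor, cost reading in TOTAL form -/

section Printed

variable {ε γ : Type*} [DecidableEq ε] {C : T4PrintedShapeBanking.Consts} {O : PrintedO1s}

/-- **MULTIPLICITY × DISCOUNTED PRINTED PRICE ≤ TREE-SLOT PRICE, COST READ IN TOTAL FORM** (IR-42-2, T1′): as
`HistoryAssemblyMult.card_mul_pshapeTH_le_priceT` with the realised-cost binder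
`hκ : lifeCost (padW (dictWT sh (R K) C.n₁) 0) κ q.2 ≤ lifeCost (padW (dictWT sh (R K) C.n₁) 0) (costT sh C K (R K)) q.2`
(R-OWNER-42-2: print's per-region-future ∕ per-merger-reserve budgets are totals); every stepwise supplier still fits
through `lifeCostT_mono`.  The per-member step (`HistoryConstantsTH.pshapeTH_mul_exp_le_shapeTH_of_slack` with the total
binder) is re-derived inside the proof from `creditsT_slack`. [folklore] -/
theorem card_mul_pshapeTH_le_priceT_total (sh : ε → PEv) {θ Λm Λr Λ' : ℝ} (hθ : 0 ≤ θ)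
    (hslack : C.a + θ ≤ O.γ₀ * O.A₁ ^ 2 / 2) (hΛm : 0 ≤ Λm) (hΛr : 0 ≤ Λr) (hΛ : Λm * Λr ≤ Λ')
    (R : ℕ → ℕ → ℕ) (g : ℕ → ℕ → ℝ) (K : ℕ) {q : γ × Gen ε} {κ : Gen ε → ℕ → ℝ} {N Ξ : ℝ}
    (hP1 : ∀ e ∈ q.2.events, (sh e).kind = 0 → 1 ≤ p0Profile C.A₀ C.p₀ (g K (sh e).step))
    (hκ : lifeCost (padW (dictWT sh (R K) C.n₁) 0) κ q.2 ≤ lifeCost (padW (dictWT sh (R K) C.n₁) 0) (costT sh C K (R K)) q.2)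
    (hN : N ≤ Real.exp (θ * birthLinT sh q.2 + Ξ) * Λm ^ partnerAges (PEv.step ∘ sh) q.2) :
    N * (pshapeTH sh O C 1 Λr (R K) (g K) 0 κ q.2 * Real.exp (-Ξ)) ≤ priceT sh C Λ' R g K q := by
  have hps : 0 ≤ pshapeTH sh O C 1 Λr (R K) (g K) 0 κ q.2 := pshapeTH_nonneg sh zero_le_one hΛr _ _ _ _ _
  have h1 : N * (pshapeTH sh O C 1 Λr (R K) (g K) 0 κ q.2 * Real.exp (-Ξ)) ≤
      Real.exp (θ * birthLinT sh q.2 + Ξ) * Λm ^ partnerAges (PEv.step ∘ sh) q.2 *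
        (pshapeTH sh O C 1 Λr (R K) (g K) 0 κ q.2 * Real.exp (-Ξ)) :=
    mul_le_mul_of_nonneg_right hN (mul_nonneg hps (Real.exp_pos _).le)
  have h2 : Real.exp (θ * birthLinT sh q.2 + Ξ) * Λm ^ partnerAges (PEv.step ∘ sh) q.2 *
      (pshapeTH sh O C 1 Λr (R K) (g K) 0 κ q.2 * Real.exp (-Ξ)) =
      Λm ^ partnerAges (PEv.step ∘ sh) q.2 *
        (pshapeTH sh O C 1 Λr (R K) (g K) 0 κ q.2 * Real.exp (θ * birthLinT sh q.2)) := by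
    have e : Real.exp (θ * birthLinT sh q.2 + Ξ) * Real.exp (-Ξ) = Real.exp (θ * birthLinT sh q.2) := by
      rw [← Real.exp_add, add_neg_cancel_right]
    calc _ = Λm ^ partnerAges (PEv.step ∘ sh) q.2 * (pshapeTH sh O C 1 Λr (R K) (g K) 0 κ q.2 *
          (Real.exp (θ * birthLinT sh q.2 + Ξ) * Real.exp (-Ξ))) := by ring
      _ = _ := by rw [e]
  -- the per-member step with the cost reading in TOTAL form (as `pshapeTH_mul_exp_le_shapeTH_of_slack`, whose proof
  -- used the stepwise binder only as `lifeCostT_mono h`)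
  have h3 : pshapeTH sh O C 1 Λr (R K) (g K) 0 κ q.2 * Real.exp (θ * birthLinT sh q.2) ≤
      HistoryConstants.shapeTH sh C 1 Λr (R K) (g K) K 0 q.2 := by
    unfold pshapeTH HistoryConstants.shapeTH
    have hc : Real.exp (-credits (pcredit O C (g K) ∘ sh) q.2) * Real.exp (θ * birthLinT sh q.2) ≤
        Real.exp (-credits (credit C (g K) ∘ sh) q.2) := by
      rw [← Real.exp_add]
      exact Real.exp_le_exp.2 (by linarith [creditsT_slack sh hθ hslack (g K) hP1])
    have hl : Real.exp (lifeCost (padW (dictWT sh (R K) C.n₁) 0) κ q.2) ≤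
        Real.exp (lifeCost (padW (dictWT sh (R K) C.n₁) 0) (costT sh C K (R K)) q.2) :=
      Real.exp_le_exp.2 hκ
    have hraw : Real.exp (-credits (pcredit O C (g K) ∘ sh) q.2) *
        Real.exp (lifeCost (padW (dictWT sh (R K) C.n₁) 0) κ q.2) * Real.exp (θ * birthLinT sh q.2) ≤
        Real.exp (-credits (credit C (g K) ∘ sh) q.2) *
          Real.exp (lifeCost (padW (dictWT sh (R K) C.n₁) 0) (costT sh C K (R K)) q.2) := by
      calc _ = Real.exp (-credits (pcredit O C (g K) ∘ sh) q.2) * Real.exp (θ * birthLinT sh q.2) *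
            Real.exp (lifeCost (padW (dictWT sh (R K) C.n₁) 0) κ q.2) := by ring
        _ ≤ _ := mul_le_mul hc hl (Real.exp_pos _).le (Real.exp_pos _).le
    have hpre : 0 ≤ (1 : ℝ) * Λr ^ partnerAges (PEv.step ∘ sh) q.2 := mul_nonneg zero_le_one (pow_nonneg hΛr _)
    calc _ = 1 * Λr ^ partnerAges (PEv.step ∘ sh) q.2 * (Real.exp (-credits (pcredit O C (g K) ∘ sh) q.2) *
          Real.exp (lifeCost (padW (dictWT sh (R K) C.n₁) 0) κ q.2) * Real.exp (θ * birthLinT sh q.2)) := by ring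
      _ ≤ 1 * Λr ^ partnerAges (PEv.step ∘ sh) q.2 * (Real.exp (-credits (credit C (g K) ∘ sh) q.2) *
          Real.exp (lifeCost (padW (dictWT sh (R K) C.n₁) 0) (costT sh C K (R K)) q.2)) :=
        mul_le_mul_of_nonneg_left hraw hpre
      _ = _ := by ring
  have hE : 0 ≤ Real.exp (-credits (credit C (g K) ∘ sh) q.2) *
      Real.exp (lifeCost (dictWT sh (R K) C.n₁) (costT sh C K (R K)) q.2) := by positivity
  have h4 : Λm ^ partnerAges (PEv.step ∘ sh) q.2 * HistoryConstants.shapeTH sh C 1 Λr (R K) (g K) K 0 q.2 ≤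
      priceT sh C Λ' R g K q := by
    rw [shapeTH_zero_one, priceT, ← mul_assoc, ← mul_pow]
    exact mul_le_mul_of_nonneg_right (pow_le_pow_left₀ (mul_nonneg hΛm hΛr) hΛ _) hE
  calc _ ≤ _ := h1
    _ = _ := h2
    _ ≤ Λm ^ partnerAges (PEv.step ∘ sh) q.2 * HistoryConstants.shapeTH sh C 1 Λr (R K) (g K) K 0 q.2 :=
      mul_le_mul_of_nonneg_left h3 (pow_nonneg hΛm _)
    _ ≤ _ := h4

/-- the landed STEPWISE lemma is the total one composed with `lifeCostT_mono` (kernel-checked round trip; binders and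
conclusion LITERALLY those of `HistoryAssemblyMult.card_mul_pshapeTH_le_priceT`). [folklore] -/
example (sh : ε → PEv) {θ Λm Λr Λ' : ℝ} (hθ : 0 ≤ θ)
    (hslack : C.a + θ ≤ O.γ₀ * O.A₁ ^ 2 / 2) (hΛm : 0 ≤ Λm) (hΛr : 0 ≤ Λr) (hΛ : Λm * Λr ≤ Λ')
    (R : ℕ → ℕ → ℕ) (g : ℕ → ℕ → ℝ) (K : ℕ) {q : γ × Gen ε} {κ : Gen ε → ℕ → ℝ} {N Ξ : ℝ}
    (hP1 : ∀ e ∈ q.2.events, (sh e).kind = 0 → 1 ≤ p0Profile C.A₀ C.p₀ (g K (sh e).step))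
    (hκ : ∀ n ∈ life (padW (dictWT sh (R K) C.n₁) 0) q.2, κ q.2 n ≤ costT sh C K (R K) q.2 n)
    (hN : N ≤ Real.exp (θ * birthLinT sh q.2 + Ξ) * Λm ^ partnerAges (PEv.step ∘ sh) q.2) :
    N * (pshapeTH sh O C 1 Λr (R K) (g K) 0 κ q.2 * Real.exp (-Ξ)) ≤ priceT sh C Λ' R g K q :=
  card_mul_pshapeTH_le_priceT_total sh hθ hslack hΛm hΛr hΛ R g K hP1 (lifeCostT_mono hκ) hN

end Printed

end

end Summit.QuantumFields.BalabanUV.T4Continuum.HistoryAssemblyMultTotal
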